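import Literature.NumberTheory.EllipticCurves.H1TrivialAction
import Literature.NumberTheory.EllipticCurves.PeriodIndexCorestriction
import Literature.NumberTheory.EllipticCurves.KummerHomsFinite
import Literature.NumberTheory.GaloisRepresentations.AbsGaloisGroup
import Literature.NumberTheory.GaloisRepresentations.ModNCyclotomicCharacter
import Mathlib.NumberTheory.Cyclotomic.CyclotomicCharacter
import Mathlib.FieldTheory.KrullTopology
import Mathlib.FieldTheory.Galois.Infinite
import Mathlib.FieldTheory.IsAlgClosed.AlgebraicClosure
import Mathlib.RingTheory.RootsOfUnity.PrimitiveRoots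
import HarnessLib

/-!
# The Kummer map `Φ : K_Pˣ × K_Pˣ → H¹(K_P, E[P])` and its Galois twist
(Clark–Sharif 2010, §2.5 and §3.5: Proposition 16, Corollary 17)

The third generic ingredient (after corestriction / Lemma 15, file `PeriodIndexCorestriction`,
and "one cocycle per class", file `H1TrivialAction`) of §3.5 of P. L. Clark, S. Sharif,
*Period, index and potential Ш*, Algebra & Number Theory 4 (2010), in the proof of their
Theorem 2 (vendored as the named fact `Literature.NumberTheory.EllipticCurves.ClarkSharif2010_thm2`
of file `PeriodIndex`): the classes `θ_n = Φ(π_n, π'_n) ∈ H¹(K_P, E[P])` whose corestrictions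
`ξ_n = cores θ_n` are the classes of Theorem 2, and the computation of `res ∘ cores ∘ Φ`.

Printed (§3.5): "As in the proof of Theorem 1, a choice of basis for `E[P]` yields an
isomorphism `Φ : K_Pˣ/K_Pˣᴾ × K_Pˣ/K_Pˣᴾ → H¹(K_P, E[P])`. […] Unfortunately, `Nm` and `Φ` do
not commute, as the Galois actions on `E[P]` and `μ_P × μ_P` differ. The representation on
`E[P]` gives, with respect to our fixed basis, a homomorphism `Gal(K_P/K) → GL₂(ℤ/Pℤ)`,
`σ ↦ M_σ = (i(σ) j(σ); k(σ) ℓ(σ))`. **Proposition 16.** Let `σ ∈ Gal(K_P/K)` and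
`(a, b) ∈ K_Pˣ/K_Pˣᴾ × K_Pˣ/K_Pˣᴾ`. Then `Φ(a, b)^σ = Φ((M_σ / det M_σ)(σa, σb))`, where
`M_σ(a, b) = (a^{i(σ)} b^{j(σ)}, a^{k(σ)} b^{ℓ(σ)})`. […] **Corollary 17.**
`Nm Φ((a, b)) = Φ(∏ σa^{i(σ)} σb^{j(σ)}, ∏ σa^{k(σ)} σb^{ℓ(σ)})`, where the product extends over
all `σ ∈ Gal(K_P/K)`."  The proof of Proposition 16 factors `Φ = λ ∘ i_* ∘ ψ` through the
Kummer map `ψ` and computes `[ψ_ρ(a,b)]^σ(γ) = σ[i(σ⁻¹ ψ(σa, σb)(γ))] = (M_σ/det M_σ) ψ_ρ(σa, σb)(γ)`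
using "`σ(ζ'₁, ζ'₂) = det M_σ · (ζ'₁, ζ'₂)`" on `μ_P × μ_P` (the Weil pairing).

This file formalises these statements **in the subgroup model** used by the tree's
corestriction: `𝔤_K = Field.absoluteGaloisGroup K`, `k ⊂ K̄` an intermediate field (`= K_P`),
`𝔤_k = fixingGal k = k.fixingSubgroup ≤ 𝔤_K`, `M` any discrete `𝔤_K`-module on which `𝔤_k`
acts trivially (`= E[P]`, rational over `K_P`), `ζ ∈ k` a primitive `P`-th root of unity
(`μ_P ⊂ K_P` by the Weil pairing), and `ρ : (ℤ/Pℤ)² →+ M` an arbitrary additive map ("choice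
of basis"; an isomorphism in the source).  The two Galois structures that the source compares
through `det M_σ` are kept separate: `σ` acts on `M` through a matrix (`hA` hypotheses) and on
`μ_P = ⟨ζ⟩` through the mod-`P` cyclotomic character `χ(σ)`, `σ • ζ = ζ^{χ(σ)}` (`cycUnit` =
Mathlib's `modularCyclotomicCharacter` on `𝔤_K` = the tree's `modNCyclotomicCharacter K P`;
`= det M_σ` for `M = E[P]`, which is not needed here).

* `rootPow ζ e = ζ^e` for `e ∈ ℤ/Pℤ`; `fixingGal k` (Mathlib's `k.fixingSubgroup` typed in `𝔤_K`);
  `pthRoot`.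
* `kummerChar k P ζ a : 𝔤_k → ℤ/Pℤ` — **the Kummer character** of `a ∈ kˣ`:
  `n • α = ζ^{f_a(n)} α` for every `P`-th root `α` of `a` (`smul_eq_rootPow_kummerChar_mul`);
  a continuous homomorphism (`kummerChar_mul`, `exists_isOpen_kummerChar_eq_zero`),
  multiplicative in `a` (`kummerChar_mul_left`, `_pow_left`, `_prod_pow_left`), trivial on
  `kˣᴾ` and ONLY there when `K̄/K` is Galois (`kummerChar_eq_zero_iff`, via Mathlib's
  `InfiniteGalois.fixedField_fixingSubgroup`); `unitChar P ζ a` — the same on units `a : kˣ`.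
* `kummerPhiCocycle hζ hζk htriv ρ a b` — **`Φ(a, b)`** as the continuous cocycle
  `n ↦ ρ(f_a(n), f_b(n))` of `𝔤_k` (a homomorphism IS a cocycle for the trivial action,
  `homCocycle`), and its class `kummerPhi … a b ∈ H¹(𝔤_k, M)`; **`Φ` is a homomorphism**
  (`kummerPhi_mul`, `kummerPhi_prod`) with **kernel `(kˣᴾ)²`** for `ρ` injective
  (`kummerPhi_eq_zero_iff`) — i.e. injective on `(kˣ/kˣᴾ)²`.
* `cycUnit` / `cycChar` (`χ(σ)`, see above), `galUnit c a = σ a ∈ kˣ` for `k/K` normal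
  (`AlgEquiv.restrictNormal`), and **`f_{σa}(n) = χ(σ) f_a(σ⁻¹ n σ)`** (`unitChar_galUnit`).
* **Proposition 16**: `conjCocycle_kummerPhiCocycle_apply` (abstract form
  `(σ · Φ(a,b))(n) = σ • ρ(χ(σ)⁻¹ f_{σa}(n), χ(σ)⁻¹ f_{σb}(n))`), `conjCocycle_kummerPhiCocycle` and
  `conjH1_kummerPhi` (matrix form `σ_* Φ(a, b) = Φ((σa)^{i/χ} (σb)^{j/χ}, (σa)^{k/χ} (σb)^{ℓ/χ})`).
* **Corollary 17**: `ClarkSharif2010_cor17` — `res (cores Φ(a, b)) = Φ(∏_x …, ∏_x …)` over a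
  system of representatives of `𝔤_K/𝔤_k = Gal(k/K)`, from
  `Literature.NumberTheory.EllipticCurves.ClarkSharif2010_lemma15` and Proposition 16.

* **`Φ` is onto** (`kummerPhiCocycle_surjective`, `kummerPhi_surjective`): for `ρ` bijective and
  `K̄/K` Galois every continuous cocycle `𝔤_k → M` is a `Φ(a, b)` — Kummer theory in `Hom` form
  (Hilbert 90), the tree's `Literature.NumberTheory.EllipticCurves.exists_kummer_generator`
  (file `KummerHomsFinite`) transported along Mathlib's
  `IntermediateField.fixingSubgroupEquiv : k.fixingSubgroup ≃* (K̄ ≃ₐ[k] K̄)`; the topological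
  input is that an open neighbourhood of `1` in `𝔤_k ≤ 𝔤_K` contains `Gal(K̄/E)` for a finite
  `E/k` (`exists_finiteDimensional_fixingSubgroup_subset`).  With the kernel computation this is
  the printed "isomorphism `Φ`" on `(kˣ/kˣᴾ)²`.

Everything here is proved; no named fact is introduced.

## References

* P. L. Clark, S. Sharif, *Period, index and potential Ш*, Algebra & Number Theory 4 (2010)
  151–174, §2.5, §3.3, §3.5 (Lemma 15, Proposition 16, Corollary 17); arXiv:0811.3019 read.
  [ClarkSharif2010]
* J. H. Silverman, *The Arithmetic of Elliptic Curves*, 2nd ed. (2009), VIII.§2 (the Kummer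
  pairing). [SilvermanAEC2009]
* J.-P. Serre, *Galois Cohomology* (1997), I.§2.3–2.5, II.§1.2. [SerreGaloisCohomology1997]
-/

noncomputable section

open scoped Classical

universe u

namespace Literature.NumberTheory.EllipticCurves

open GaloisRepresentations Field

/-! ## Powers of a root of unity indexed by `ZMod P` -/

section RootPow

variable {R : Type*} [CommRing R] {P : ℕ}

/-- `ζ ^ e` for an exponent `e ∈ ℤ/Pℤ` (through the representative `e.val < P`); for `ζ ^ P = 1`
this is a homomorphism `ℤ/Pℤ → Rˣ`, an isomorphism onto `μ_P` when `ζ` is a primitive `P`-th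
root of unity. [folklore] -/
def rootPow (ζ : R) (e : ZMod P) : R :=
  ζ ^ e.val

/-- `rootPow ζ 0 = 1`. [folklore] -/
@[simp]
theorem rootPow_zero (ζ : R) : rootPow ζ (0 : ZMod P) = 1 := by
  rw [rootPow, ZMod.val_zero, pow_zero]

/-- `ζ ^ n` only depends on `n mod P` when `ζ ^ P = 1`. [folklore] -/
theorem pow_eq_pow_mod_of_pow_eq_one {ζ : R} (hζ : ζ ^ P = 1) (n : ℕ) : ζ ^ n = ζ ^ (n % P) := by
  conv_lhs => rw [← Nat.div_add_mod n P, pow_add, pow_mul, hζ, one_pow, one_mul]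

/-- `rootPow ζ n = ζ ^ n` for `n : ℕ`. [folklore] -/
theorem rootPow_natCast {ζ : R} (hζ : ζ ^ P = 1) (n : ℕ) : rootPow ζ (n : ZMod P) = ζ ^ n := by
  rw [rootPow, ZMod.val_natCast, ← pow_eq_pow_mod_of_pow_eq_one hζ]

/-- `rootPow ζ` is additive-to-multiplicative. [folklore] -/
theorem rootPow_add [NeZero P] {ζ : R} (hζ : ζ ^ P = 1) (e e' : ZMod P) :
    rootPow ζ (e + e') = rootPow ζ e * rootPow ζ e' := by
  rw [rootPow, ZMod.val_add, ← pow_eq_pow_mod_of_pow_eq_one hζ, pow_add]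
  rfl

/-- `rootPow ζ (e * e') = (rootPow ζ e') ^ e.val`. [folklore] -/
theorem rootPow_mul {ζ : R} (hζ : ζ ^ P = 1) (e e' : ZMod P) :
    rootPow ζ (e * e') = rootPow ζ e' ^ e.val := by
  rw [rootPow, rootPow, ZMod.val_mul, ← pow_eq_pow_mod_of_pow_eq_one hζ, mul_comm, pow_mul]

/-- `rootPow ζ (n • e) = (rootPow ζ e) ^ n`. [folklore] -/
theorem rootPow_nsmul [NeZero P] {ζ : R} (hζ : ζ ^ P = 1) (n : ℕ) (e : ZMod P) :
    rootPow ζ (n • e) = rootPow ζ e ^ n := by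
  induction n with
  | zero => rw [zero_smul, rootPow_zero, pow_zero]
  | succ n ih => rw [succ_nsmul, rootPow_add hζ, ih, pow_succ]

/-- `(rootPow ζ e) ^ P = 1`. [folklore] -/
theorem rootPow_pow_eq_one {ζ : R} (hζ : ζ ^ P = 1) (e : ZMod P) : rootPow ζ e ^ P = 1 := by
  rw [rootPow, ← pow_mul, mul_comm, pow_mul, hζ, one_pow]

/-- For a primitive `P`-th root of unity, `rootPow ζ : ℤ/Pℤ → R` is injective. [folklore] -/
theorem rootPow_injective [NeZero P] {ζ : R} (hζ : IsPrimitiveRoot ζ P) :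
    Function.Injective (rootPow ζ : ZMod P → R) := fun e e' h ↦
  ZMod.val_injective P (hζ.pow_inj (ZMod.val_lt e) (ZMod.val_lt e') h)

/-- For a primitive `P`-th root of unity every `P`-th root of unity is a `rootPow ζ e`.
[folklore] -/
theorem exists_rootPow_eq [IsDomain R] [NeZero P] {ζ : R} (hζ : IsPrimitiveRoot ζ P) {ξ : R}
    (hξ : ξ ^ P = 1) : ∃ e : ZMod P, rootPow ζ e = ξ := by
  obtain ⟨i, -, rfl⟩ := hζ.eq_pow_of_pow_eq_one hξ
  exact ⟨i, rootPow_natCast hζ.pow_eq_one i⟩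

/-- A ring homomorphism sends `rootPow ζ e` to `rootPow (f ζ) e`. [folklore] -/
theorem map_rootPow {S : Type*} [CommRing S] (f : R →+* S) (ζ : R) (e : ZMod P) :
    f (rootPow ζ e) = rootPow (f ζ) e :=
  map_pow f ζ _

end RootPow

/-! ## `Γ_k ≤ Γ_K` for an intermediate field `K ⊆ k ⊆ K̄`, and `P`-th roots in `K̄` -/

section GalFixing

variable {K : Type u} [Field K]

/-- **`𝔤_k = Gal(K̄/k)` as an (open, for `k/K` finite) subgroup of `𝔤_K = Gal(K̄/K)`** for an
intermediate field `K ⊆ k ⊆ K̄`: this is Mathlib's `k.fixingSubgroup` (the survivor; all Mathlib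
API — `IntermediateField.mem_fixingSubgroup_iff`, `fixingSubgroup_isOpen`,
`InfiniteGalois.fixedField_fixingSubgroup`, `fixingSubgroupEquiv`, … — applies verbatim),
merely TYPED as a subgroup of `Field.absoluteGaloisGroup K` so that a discrete `𝔤_K`-module
restricts to it by instance resolution (`Subgroup.smul_def`).  It is the same subgroup as
`Literature.NumberTheory.GaloisRepresentations.galFixing K k` of `LocalWeilDatum` (defined there
as the `comap` of `k.fixingSubgroup` through the identity `absoluteGaloisGroup.toAlgEquiv K`),
which is not imported here so as to keep this file out of the local class field theory closure.
Clark–Sharif's `𝔤_{K_P} ≤ 𝔤_K` (§3.3, §3.5). [cite: ClarkSharif2010, §3.3] -/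
abbrev fixingGal (k : IntermediateField K (AlgebraicClosure K)) : Subgroup (absoluteGaloisGroup K) :=
  k.fixingSubgroup

variable {k : IntermediateField K (AlgebraicClosure K)}

/-- Elements of `𝔤_k` fix `k` pointwise. [folklore] -/
theorem smul_eq_self_of_mem_fixingGal {n : absoluteGaloisGroup K} (hn : n ∈ fixingGal k)
    {x : AlgebraicClosure K} (hx : x ∈ k) : n • x = x :=
  (IntermediateField.mem_fixingSubgroup_iff k n).mp hn x hx

/-- Elements of `𝔤_k` fix `k` pointwise (subtype form). [folklore] -/
theorem fixingGal_smul_eq_self (n : fixingGal k) {x : AlgebraicClosure K} (hx : x ∈ k) :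
    (n : absoluteGaloisGroup K) • x = x :=
  smul_eq_self_of_mem_fixingGal n.2 hx

variable (P : ℕ) [NeZero P]

/-- A chosen `P`-th root in `K̄` (`K̄` is algebraically closed). [folklore] -/
def pthRoot (a : AlgebraicClosure K) : AlgebraicClosure K :=
  Classical.choose (IsAlgClosed.exists_pow_nat_eq a (NeZero.pos P))

/-- `(pthRoot P a) ^ P = a`. [folklore] -/
@[simp]
theorem pthRoot_pow (a : AlgebraicClosure K) : pthRoot P a ^ P = a :=
  Classical.choose_spec (IsAlgClosed.exists_pow_nat_eq a (NeZero.pos P))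

variable {P}

/-- A `P`-th root of a nonzero element is nonzero. [folklore] -/
theorem ne_zero_of_pow_eq {α a : AlgebraicClosure K} (hα : α ^ P = a) (ha : a ≠ 0) : α ≠ 0 := by
  rintro rfl
  rw [zero_pow (NeZero.ne P)] at hα
  exact ha hα.symm

/-- Two `P`-th roots of the same nonzero element differ by a `P`-th root of unity. [folklore] -/
theorem exists_rootPow_mul_eq_of_pow_eq {ζ : AlgebraicClosure K} (hζ : IsPrimitiveRoot ζ P)
    {α α' a : AlgebraicClosure K} (hα : α ^ P = a) (hα' : α' ^ P = a) (ha : a ≠ 0) :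
    ∃ e : ZMod P, α' = rootPow ζ e * α := by
  have hα0 : α ≠ 0 := ne_zero_of_pow_eq hα ha
  have h1 : (α' * α⁻¹) ^ P = 1 := by
    rw [mul_pow, inv_pow, hα, hα', mul_inv_cancel₀ ha]
  obtain ⟨e, he⟩ := exists_rootPow_eq hζ h1
  exact ⟨e, by rw [he, inv_mul_cancel_right₀ hα0]⟩

omit [NeZero P] in
/-- An element of `𝔤_K` sends a `P`-th root of `a` to a `P`-th root of `σ • a`. [folklore] -/
theorem smul_pow_eq (σ : absoluteGaloisGroup K) {α a : AlgebraicClosure K} (hα : α ^ P = a) :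
    (σ • α) ^ P = σ • a := by
  rw [← smul_pow', hα]

end GalFixing

/-! ## Kummer characters of `𝔤_k` -/

section KummerChar

variable {K : Type u} [Field K] {k : IntermediateField K (AlgebraicClosure K)} {P : ℕ} [NeZero P]
  {ζ : AlgebraicClosure K}

variable (k P ζ) in
/-- **The Kummer character `f_a : 𝔤_k → ℤ/Pℤ` of `a ∈ kˣ`** with respect to the primitive
`P`-th root of unity `ζ ∈ k`: `n • α = ζ^{f_a(n)} α` for one (equivalently every,
`smul_eq_rootPow_kummerChar_mul`) `P`-th root `α` of `a` (junk value `0` where no such exponent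
exists). This is the Kummer map `ψ : kˣ/kˣᴾ → H¹(k, μ_P) = Hom(𝔤_k, μ_P)` of Clark–Sharif §2.5 /
§3.5 followed by the identification `μ_P = ⟨ζ⟩ ≅ ℤ/Pℤ`. Silverman, *AEC*, VIII.§2;
Clark–Sharif 2010, §3.5 ("`ψ` is the Kummer map"). [cite: ClarkSharif2010, §3.5] -/
def kummerChar (a : AlgebraicClosure K) (n : fixingGal k) : ZMod P :=
  if h : ∃ e : ZMod P, (n : absoluteGaloisGroup K) • pthRoot P a = rootPow ζ e * pthRoot P a then
    Classical.choose h
  else 0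

/-- Existence of the Kummer exponent on the chosen root. [folklore] -/
theorem exists_smul_pthRoot_eq (hζ : IsPrimitiveRoot ζ P) {a : AlgebraicClosure K} (ha : a ∈ k)
    (ha0 : a ≠ 0) (n : fixingGal k) :
    ∃ e : ZMod P, (n : absoluteGaloisGroup K) • pthRoot P a = rootPow ζ e * pthRoot P a :=
  exists_rootPow_mul_eq_of_pow_eq hζ (pthRoot_pow P a)
    ((smul_pow_eq _ (pthRoot_pow P a)).trans (fixingGal_smul_eq_self n ha)) ha0

/-- **Defining property of the Kummer character** on the chosen root:
`n • α = ζ^{f_a(n)} α`. [cite: ClarkSharif2010, §3.5] -/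
theorem smul_pthRoot_eq (hζ : IsPrimitiveRoot ζ P) {a : AlgebraicClosure K} (ha : a ∈ k)
    (ha0 : a ≠ 0) (n : fixingGal k) :
    (n : absoluteGaloisGroup K) • pthRoot P a = rootPow ζ (kummerChar k P ζ a n) * pthRoot P a := by
  have h := exists_smul_pthRoot_eq hζ ha ha0 n
  rw [kummerChar, dif_pos h]
  exact Classical.choose_spec h

/-- **Uniqueness of the Kummer exponent**: `ζ^e α = ζ^{e'} α` with `α ≠ 0` forces `e = e'`.
[folklore] -/
theorem rootPow_mul_cancel (hζ : IsPrimitiveRoot ζ P) {α : AlgebraicClosure K} (hα : α ≠ 0)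
    {e e' : ZMod P} (h : rootPow ζ e * α = rootPow ζ e' * α) : e = e' :=
  rootPow_injective hζ (mul_right_cancel₀ hα h)

/-- The Kummer character is characterised by its defining property on the chosen root.
[folklore] -/
theorem kummerChar_eq_of_smul_pthRoot_eq (hζ : IsPrimitiveRoot ζ P) {a : AlgebraicClosure K}
    (ha : a ∈ k) (ha0 : a ≠ 0) (n : fixingGal k) {e : ZMod P}
    (h : (n : absoluteGaloisGroup K) • pthRoot P a = rootPow ζ e * pthRoot P a) :
    kummerChar k P ζ a n = e :=
  rootPow_mul_cancel hζ (ne_zero_of_pow_eq (pthRoot_pow P a) ha0)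
    ((smul_pthRoot_eq hζ ha ha0 n).symm.trans h)

/-- **Independence of the root**: `n • α = ζ^{f_a(n)} α` for EVERY `P`-th root `α` of `a`
(two roots differ by a power of `ζ ∈ k`, fixed by `𝔤_k`). Silverman, *AEC*, VIII.§2.
[folklore] -/
theorem smul_eq_rootPow_kummerChar_mul (hζ : IsPrimitiveRoot ζ P) (hζk : ζ ∈ k)
    {a : AlgebraicClosure K} (ha : a ∈ k) (ha0 : a ≠ 0) (n : fixingGal k)
    {α : AlgebraicClosure K} (hα : α ^ P = a) :
    (n : absoluteGaloisGroup K) • α = rootPow ζ (kummerChar k P ζ a n) * α := by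
  obtain ⟨e, rfl⟩ := exists_rootPow_mul_eq_of_pow_eq hζ (pthRoot_pow P a) hα ha0
  have hfix : (n : absoluteGaloisGroup K) • rootPow ζ e = rootPow ζ e := by
    rw [rootPow, smul_pow', fixingGal_smul_eq_self n hζk]
  rw [smul_mul', hfix, smul_pthRoot_eq hζ ha ha0 n, mul_left_comm]

/-- The Kummer character is characterised by its defining property on ANY root. [folklore] -/
theorem kummerChar_eq_of_smul_eq (hζ : IsPrimitiveRoot ζ P) (hζk : ζ ∈ k)
    {a : AlgebraicClosure K} (ha : a ∈ k) (ha0 : a ≠ 0) (n : fixingGal k)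
    {α : AlgebraicClosure K} (hα : α ^ P = a) {e : ZMod P}
    (h : (n : absoluteGaloisGroup K) • α = rootPow ζ e * α) : kummerChar k P ζ a n = e :=
  rootPow_mul_cancel hζ (ne_zero_of_pow_eq hα ha0)
    ((smul_eq_rootPow_kummerChar_mul hζ hζk ha ha0 n hα).symm.trans h)

/-- **The Kummer character is a homomorphism**: `f_a(nm) = f_a(n) + f_a(m)`.
Silverman, *AEC*, VIII.§2. [folklore] -/
theorem kummerChar_mul (hζ : IsPrimitiveRoot ζ P) (hζk : ζ ∈ k) {a : AlgebraicClosure K}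
    (ha : a ∈ k) (ha0 : a ≠ 0) (n m : fixingGal k) :
    kummerChar k P ζ a (n * m) = kummerChar k P ζ a n + kummerChar k P ζ a m := by
  apply kummerChar_eq_of_smul_pthRoot_eq hζ ha ha0
  have hfix : (n : absoluteGaloisGroup K) • rootPow ζ (kummerChar k P ζ a m) =
      rootPow ζ (kummerChar k P ζ a m) := by
    rw [rootPow, smul_pow', fixingGal_smul_eq_self n hζk]
  rw [Subgroup.coe_mul, mul_smul, smul_pthRoot_eq hζ ha ha0 m, smul_mul', hfix,
    smul_pthRoot_eq hζ ha ha0 n, rootPow_add hζ.pow_eq_one, mul_assoc, mul_left_comm]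

/-- `f_a(1) = 0`. [folklore] -/
theorem kummerChar_one (hζ : IsPrimitiveRoot ζ P) (hζk : ζ ∈ k) {a : AlgebraicClosure K}
    (ha : a ∈ k) (ha0 : a ≠ 0) : kummerChar k P ζ a 1 = 0 := by
  have h := kummerChar_mul hζ hζk ha ha0 1 1
  rw [mul_one] at h
  exact left_eq_add.mp h

/-- **The Kummer map is multiplicative in `a`**: `f_{ab} = f_a + f_b` (a product of `P`-th
roots of `a` and `b` is a `P`-th root of `ab`). Silverman, *AEC*, VIII.§2. [folklore] -/
theorem kummerChar_mul_left (hζ : IsPrimitiveRoot ζ P) (hζk : ζ ∈ k) {a b : AlgebraicClosure K}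
    (ha : a ∈ k) (ha0 : a ≠ 0) (hb : b ∈ k) (hb0 : b ≠ 0) (n : fixingGal k) :
    kummerChar k P ζ (a * b) n = kummerChar k P ζ a n + kummerChar k P ζ b n := by
  apply kummerChar_eq_of_smul_eq hζ hζk (k.mul_mem ha hb) (mul_ne_zero ha0 hb0) n
    (α := pthRoot P a * pthRoot P b)
  · rw [mul_pow, pthRoot_pow, pthRoot_pow]
  · rw [smul_mul', smul_pthRoot_eq hζ ha ha0 n, smul_pthRoot_eq hζ hb hb0 n,
      rootPow_add hζ.pow_eq_one]
    ring

/-- `f_1 = 0` (the constant `1 ∈ kˣ`). [folklore] -/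
theorem kummerChar_one_left (hζ : IsPrimitiveRoot ζ P) (hζk : ζ ∈ k) (n : fixingGal k) :
    kummerChar k P ζ 1 n = 0 := by
  have h := kummerChar_mul_left hζ hζk k.one_mem one_ne_zero k.one_mem one_ne_zero n
  rw [mul_one] at h
  exact left_eq_add.mp h

/-- `f_{a ^ m} = m • f_a`. [folklore] -/
theorem kummerChar_pow_left (hζ : IsPrimitiveRoot ζ P) (hζk : ζ ∈ k) {a : AlgebraicClosure K}
    (ha : a ∈ k) (ha0 : a ≠ 0) (m : ℕ) (n : fixingGal k) :
    kummerChar k P ζ (a ^ m) n = m • kummerChar k P ζ a n := by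
  induction m with
  | zero => rw [pow_zero, zero_smul, kummerChar_one_left hζ hζk]
  | succ m ih =>
    rw [pow_succ, kummerChar_mul_left hζ hζk (pow_mem ha m) (pow_ne_zero m ha0) ha ha0, ih,
      succ_nsmul]

/-- `f_{∏ a_i ^ m_i} = Σ m_i • f_{a_i}`. [folklore] -/
theorem kummerChar_prod_pow_left (hζ : IsPrimitiveRoot ζ P) (hζk : ζ ∈ k) {ι : Type*}
    (s : Finset ι) {a : ι → AlgebraicClosure K} (ha : ∀ i ∈ s, a i ∈ k) (ha0 : ∀ i ∈ s, a i ≠ 0)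
    (m : ι → ℕ) (n : fixingGal k) :
    kummerChar k P ζ (∏ i ∈ s, a i ^ m i) n = ∑ i ∈ s, m i • kummerChar k P ζ (a i) n := by
  induction s using Finset.induction_on with
  | empty => rw [Finset.prod_empty, Finset.sum_empty, kummerChar_one_left hζ hζk]
  | insert i s hi ih =>
    rw [Finset.prod_insert hi, Finset.sum_insert hi,
      kummerChar_mul_left hζ hζk (pow_mem (ha i (Finset.mem_insert_self i s)) (m i))
        (pow_ne_zero (m i) (ha0 i (Finset.mem_insert_self i s)))
        (prod_mem fun j hj ↦ pow_mem (ha j (Finset.mem_insert_of_mem hj)) (m j))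
        (Finset.prod_ne_zero_iff.mpr fun j hj ↦
          pow_ne_zero (m j) (ha0 j (Finset.mem_insert_of_mem hj))),
      kummerChar_pow_left hζ hζk (ha i (Finset.mem_insert_self i s))
        (ha0 i (Finset.mem_insert_self i s)),
      ih (fun j hj ↦ ha j (Finset.mem_insert_of_mem hj)) fun j hj ↦ ha0 j (Finset.mem_insert_of_mem hj)]

/-- **`P`-th powers have trivial Kummer character**: `f_{b^P} = 0` for `b ∈ kˣ` (the root
`b ∈ k` is fixed by `𝔤_k`). Silverman, *AEC*, VIII.§2. [folklore] -/
theorem kummerChar_pow_eq_zero (hζ : IsPrimitiveRoot ζ P) (hζk : ζ ∈ k) {b : AlgebraicClosure K}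
    (hb : b ∈ k) (hb0 : b ≠ 0) (n : fixingGal k) : kummerChar k P ζ (b ^ P) n = 0 :=
  kummerChar_eq_of_smul_eq hζ hζk (pow_mem hb P) (pow_ne_zero P hb0) n rfl
    (by rw [fixingGal_smul_eq_self n hb, rootPow_zero, one_mul])

/-- The Kummer character only depends on the class of `a` modulo `P`-th powers:
`f_{a b^P} = f_a`. [folklore] -/
theorem kummerChar_mul_pow (hζ : IsPrimitiveRoot ζ P) (hζk : ζ ∈ k) {a b : AlgebraicClosure K}
    (ha : a ∈ k) (ha0 : a ≠ 0) (hb : b ∈ k) (hb0 : b ≠ 0) (n : fixingGal k) :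
    kummerChar k P ζ (a * b ^ P) n = kummerChar k P ζ a n := by
  rw [kummerChar_mul_left hζ hζk ha ha0 (pow_mem hb P) (pow_ne_zero P hb0),
    kummerChar_pow_eq_zero hζ hζk hb hb0, add_zero]

/-- **The kernel of the Kummer map** (`K̄/K` Galois, e.g. `K` of characteristic `0`): `f_a = 0`
iff `a ∈ kˣᴾ`. If `f_a = 0` then a `P`-th root `α` of `a` is fixed by `𝔤_k`, hence lies in `k`
(the fixed field of `𝔤_k` is `k`, Mathlib's `InfiniteGalois.fixedField_fixingSubgroup`).
Silverman, *AEC*, VIII.§2 (injectivity of `kˣ/kˣᴾ → H¹(k, μ_P)`). [folklore] -/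
theorem kummerChar_eq_zero_iff [IsGalois K (AlgebraicClosure K)] (hζ : IsPrimitiveRoot ζ P)
    (hζk : ζ ∈ k) {a : AlgebraicClosure K} (ha : a ∈ k) (ha0 : a ≠ 0) :
    (∀ n, kummerChar k P ζ a n = 0) ↔ ∃ b ∈ k, b ^ P = a := by
  constructor
  · intro h
    refine ⟨pthRoot P a, ?_, pthRoot_pow P a⟩
    have hfix : ∀ n : fixingGal k, (n : absoluteGaloisGroup K) • pthRoot P a = pthRoot P a := by
      intro n
      rw [smul_pthRoot_eq hζ ha ha0 n, h n, rootPow_zero, one_mul]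
    have hmem : pthRoot P a ∈ IntermediateField.fixedField k.fixingSubgroup := by
      rw [IntermediateField.mem_fixedField_iff]
      intro σ hσ
      exact hfix ⟨σ, hσ⟩
    rwa [InfiniteGalois.fixedField_fixingSubgroup] at hmem
  · rintro ⟨b, hb, rfl⟩ n
    have hb0 : b ≠ 0 := by
      rintro rfl
      exact ha0 (zero_pow (NeZero.ne P))
    exact kummerChar_pow_eq_zero hζ hζk hb hb0 n

/-- **Continuity of the Kummer character**: `f_a` vanishes on the open subgroup
`𝔤_k ∩ Gal(K̄/K(α))` of `𝔤_k` (`K(α)/K` is finite since `α` is algebraic over `K`).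
[folklore] -/
theorem exists_isOpen_kummerChar_eq_zero (hζ : IsPrimitiveRoot ζ P) {a : AlgebraicClosure K}
    (ha : a ∈ k) (ha0 : a ≠ 0) :
    ∃ U : Subgroup (fixingGal k), IsOpen (U : Set (fixingGal k)) ∧
      ∀ u ∈ U, kummerChar k P ζ a u = 0 := by
  let α : AlgebraicClosure K := pthRoot P a
  let E : IntermediateField K (AlgebraicClosure K) := IntermediateField.adjoin K {α}
  haveI : FiniteDimensional K E :=
    IntermediateField.adjoin.finiteDimensional (Algebra.IsIntegral.isIntegral α)
  refine ⟨(fixingGal E).comap (fixingGal k).subtype, ?_, fun u hu ↦ ?_⟩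
  · exact (IntermediateField.fixingSubgroup_isOpen E).preimage continuous_subtype_val
  · apply kummerChar_eq_of_smul_pthRoot_eq hζ ha ha0 u
    rw [rootPow_zero, one_mul]
    exact smul_eq_self_of_mem_fixingGal (Subgroup.mem_comap.mp hu)
      (IntermediateField.mem_adjoin_simple_self K α)

end KummerChar

/-! ## Units of `k` and their Kummer characters -/

section Units

variable {K : Type u} [Field K] {k : IntermediateField K (AlgebraicClosure K)} {P : ℕ} [NeZero P]
  {ζ : AlgebraicClosure K}

/-- A unit of `k` lies in `k` (as an element of `K̄`). [folklore] -/
theorem units_coe_mem (a : (↥k)ˣ) : ((a : k) : AlgebraicClosure K) ∈ k :=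
  (a : k).2

/-- A unit of `k` is nonzero in `K̄`. [folklore] -/
theorem units_coe_ne_zero (a : (↥k)ˣ) : ((a : k) : AlgebraicClosure K) ≠ 0 := fun h ↦
  a.ne_zero (ZeroMemClass.coe_eq_zero.mp h)

/-- Coercion of a product of units. [folklore] -/
theorem units_coe_mul (a b : (↥k)ˣ) :
    (((a * b : (↥k)ˣ) : k) : AlgebraicClosure K) = ((a : k) : AlgebraicClosure K) * (b : k) := by
  rw [Units.val_mul, MulMemClass.coe_mul]

/-- Coercion of a power of a unit. [folklore] -/
theorem units_coe_pow (a : (↥k)ˣ) (m : ℕ) :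
    (((a ^ m : (↥k)ˣ) : k) : AlgebraicClosure K) = ((a : k) : AlgebraicClosure K) ^ m := by
  rw [Units.val_pow_eq_pow_val, SubmonoidClass.coe_pow]

/-- Coercion of `1`. [folklore] -/
theorem units_coe_one : (((1 : (↥k)ˣ) : k) : AlgebraicClosure K) = 1 := by
  rw [Units.val_one, OneMemClass.coe_one]

variable (P ζ) in
/-- **The Kummer character `f_a : 𝔤_k → ℤ/Pℤ` of a unit `a ∈ kˣ`** (`kummerChar` on `kˣ`):
`n • α = ζ^{f_a(n)} α` for every `P`-th root `α` of `a`. Clark–Sharif 2010, §2.5 / §3.5 (the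
Kummer map `ψ`); Silverman, *AEC*, VIII.§2. [cite: ClarkSharif2010, §3.5] -/
def unitChar (a : (↥k)ˣ) (n : fixingGal k) : ZMod P :=
  kummerChar k P ζ ((a : k) : AlgebraicClosure K) n

/-- `n • α = ζ^{f_a(n)} α` for every `P`-th root `α` of the unit `a`. [cite: ClarkSharif2010, §3.5] -/
theorem smul_eq_rootPow_unitChar_mul (hζ : IsPrimitiveRoot ζ P) (hζk : ζ ∈ k) (a : (↥k)ˣ)
    (n : fixingGal k) {α : AlgebraicClosure K} (hα : α ^ P = ((a : k) : AlgebraicClosure K)) :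
    (n : absoluteGaloisGroup K) • α = rootPow ζ (unitChar P ζ a n) * α :=
  smul_eq_rootPow_kummerChar_mul hζ hζk (units_coe_mem a) (units_coe_ne_zero a) n hα

/-- The Kummer character of a unit is characterised by `n • α = ζ^e α` on any root. [folklore] -/
theorem unitChar_eq_of_smul_eq (hζ : IsPrimitiveRoot ζ P) (hζk : ζ ∈ k) (a : (↥k)ˣ)
    (n : fixingGal k) {α : AlgebraicClosure K} (hα : α ^ P = ((a : k) : AlgebraicClosure K))
    {e : ZMod P} (h : (n : absoluteGaloisGroup K) • α = rootPow ζ e * α) : unitChar P ζ a n = e :=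
  kummerChar_eq_of_smul_eq hζ hζk (units_coe_mem a) (units_coe_ne_zero a) n hα h

/-- `f_a(nm) = f_a(n) + f_a(m)`. [folklore] -/
theorem unitChar_mul (hζ : IsPrimitiveRoot ζ P) (hζk : ζ ∈ k) (a : (↥k)ˣ) (n m : fixingGal k) :
    unitChar P ζ a (n * m) = unitChar P ζ a n + unitChar P ζ a m :=
  kummerChar_mul hζ hζk (units_coe_mem a) (units_coe_ne_zero a) n m

/-- `f_{ab} = f_a + f_b`. [folklore] -/
theorem unitChar_mul_left (hζ : IsPrimitiveRoot ζ P) (hζk : ζ ∈ k) (a b : (↥k)ˣ)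
    (n : fixingGal k) : unitChar P ζ (a * b) n = unitChar P ζ a n + unitChar P ζ b n := by
  rw [unitChar, units_coe_mul]
  exact kummerChar_mul_left hζ hζk (units_coe_mem a) (units_coe_ne_zero a) (units_coe_mem b)
    (units_coe_ne_zero b) n

/-- `f_1 = 0`. [folklore] -/
theorem unitChar_one_left (hζ : IsPrimitiveRoot ζ P) (hζk : ζ ∈ k) (n : fixingGal k) :
    unitChar P ζ (1 : (↥k)ˣ) n = 0 := by
  rw [unitChar, units_coe_one]
  exact kummerChar_one_left hζ hζk n

/-- `f_{a ^ m} = m • f_a`. [folklore] -/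
theorem unitChar_pow_left (hζ : IsPrimitiveRoot ζ P) (hζk : ζ ∈ k) (a : (↥k)ˣ) (m : ℕ)
    (n : fixingGal k) : unitChar P ζ (a ^ m) n = m • unitChar P ζ a n := by
  rw [unitChar, units_coe_pow]
  exact kummerChar_pow_left hζ hζk (units_coe_mem a) (units_coe_ne_zero a) m n

/-- `f_{a⁻¹} = -f_a`. [folklore] -/
theorem unitChar_inv_left (hζ : IsPrimitiveRoot ζ P) (hζk : ζ ∈ k) (a : (↥k)ˣ)
    (n : fixingGal k) : unitChar P ζ a⁻¹ n = -unitChar P ζ a n := by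
  have h := unitChar_mul_left hζ hζk a⁻¹ a n
  rw [inv_mul_cancel, unitChar_one_left hζ hζk] at h
  exact eq_neg_of_add_eq_zero_left h.symm

/-- `f_{a ^ m} = m • f_a` for `m : ℤ`. [folklore] -/
theorem unitChar_zpow_left (hζ : IsPrimitiveRoot ζ P) (hζk : ζ ∈ k) (a : (↥k)ˣ) (m : ℤ)
    (n : fixingGal k) : unitChar P ζ (a ^ m) n = m • unitChar P ζ a n := by
  obtain ⟨m, rfl | rfl⟩ := m.eq_nat_or_neg
  · rw [zpow_natCast, natCast_zsmul, unitChar_pow_left hζ hζk]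
  · rw [zpow_neg, zpow_natCast, neg_smul, natCast_zsmul, ← unitChar_pow_left hζ hζk,
      ← unitChar_inv_left hζ hζk]

/-- `f_{∏ a_i ^ m_i} = Σ m_i • f_{a_i}` (`m_i : ℤ`). [folklore] -/
theorem unitChar_prod_zpow_left (hζ : IsPrimitiveRoot ζ P) (hζk : ζ ∈ k) {ι : Type*} (s : Finset ι)
    (a : ι → (↥k)ˣ) (m : ι → ℤ) (n : fixingGal k) :
    unitChar P ζ (∏ i ∈ s, a i ^ m i) n = ∑ i ∈ s, m i • unitChar P ζ (a i) n := by
  induction s using Finset.induction_on with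
  | empty => rw [Finset.prod_empty, Finset.sum_empty, unitChar_one_left hζ hζk]
  | insert i s hi ih =>
    rw [Finset.prod_insert hi, Finset.sum_insert hi, unitChar_mul_left hζ hζk,
      unitChar_zpow_left hζ hζk, ih]

/-- **Kernel of the Kummer map on `kˣ`** (`K̄/K` Galois): `f_a = 0 ↔ a ∈ (kˣ)ᴾ`.
Silverman, *AEC*, VIII.§2. [folklore] -/
theorem unitChar_eq_zero_iff [IsGalois K (AlgebraicClosure K)] (hζ : IsPrimitiveRoot ζ P)
    (hζk : ζ ∈ k) (a : (↥k)ˣ) :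
    (∀ n, unitChar P ζ a n = 0) ↔ ∃ b : (↥k)ˣ, b ^ P = a := by
  rw [show (∀ n, unitChar P ζ a n = 0) ↔ ∀ n, kummerChar k P ζ ((a : k) : AlgebraicClosure K) n = 0
    from Iff.rfl, kummerChar_eq_zero_iff hζ hζk (units_coe_mem a) (units_coe_ne_zero a)]
  constructor
  · rintro ⟨b, hb, hba⟩
    have hb0 : (⟨b, hb⟩ : k) ≠ 0 := fun h ↦ by
      have h' : b = 0 := congrArg Subtype.val h
      rw [h', zero_pow (NeZero.ne P)] at hba
      exact units_coe_ne_zero a hba.symm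
    refine ⟨Units.mk0 ⟨b, hb⟩ hb0, Units.ext (Subtype.ext ?_)⟩
    rw [Units.val_pow_eq_pow_val, Units.val_mk0, SubmonoidClass.coe_pow]
    exact hba
  · rintro ⟨b, rfl⟩
    exact ⟨(b : k), (b : k).2, (units_coe_pow b P).symm⟩

/-- Continuity: `f_a` vanishes on an open subgroup of `𝔤_k`. [folklore] -/
theorem exists_isOpen_unitChar_eq_zero (hζ : IsPrimitiveRoot ζ P) (a : (↥k)ˣ) :
    ∃ U : Subgroup (fixingGal k), IsOpen (U : Set (fixingGal k)) ∧ ∀ u ∈ U, unitChar P ζ a u = 0 :=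
  exists_isOpen_kummerChar_eq_zero hζ (units_coe_mem a) (units_coe_ne_zero a)

end Units

/-! ## `Φ : kˣ × kˣ → Z¹(𝔤_k, M) = H¹(𝔤_k, M)` -/

section Phi

variable {K : Type u} [Field K] {k : IntermediateField K (AlgebraicClosure K)} {P : ℕ} [NeZero P]
  {ζ : AlgebraicClosure K}
variable {M : Type u} [AddCommGroup M] [DistribMulAction (absoluteGaloisGroup K) M]
  [TopologicalSpace M] [DiscreteTopology M]

variable (P ζ) in
/-- The function `n ↦ ρ(f_a(n), f_b(n))` underlying `Φ(a, b)`, for a "choice of basis"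
`ρ : (ℤ/Pℤ)² → M` (in Clark–Sharif, `M = E[P]` and `ρ` is the isomorphism given by a basis of
`E[P]` and `ζ`). [cite: ClarkSharif2010, §3.5] -/
def kummerPhiFun (ρ : ZMod P × ZMod P →+ M) (a b : (↥k)ˣ) (n : fixingGal k) : M :=
  ρ (unitChar P ζ a n, unitChar P ζ b n)

omit [DistribMulAction (absoluteGaloisGroup K) M] [TopologicalSpace M] [DiscreteTopology M] in
/-- `kummerPhiFun` is a homomorphism on `𝔤_k`. [folklore] -/
theorem kummerPhiFun_mul (hζ : IsPrimitiveRoot ζ P) (hζk : ζ ∈ k) (ρ : ZMod P × ZMod P →+ M)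
    (a b : (↥k)ˣ) (n m : fixingGal k) :
    kummerPhiFun P ζ ρ a b (n * m) = kummerPhiFun P ζ ρ a b n + kummerPhiFun P ζ ρ a b m := by
  rw [kummerPhiFun, kummerPhiFun, kummerPhiFun, unitChar_mul hζ hζk, unitChar_mul hζ hζk,
    ← map_add, Prod.mk_add_mk]

omit [DistribMulAction (absoluteGaloisGroup K) M] [DiscreteTopology M] in
/-- `kummerPhiFun` is continuous (it vanishes on an open subgroup of `𝔤_k`). [folklore] -/
theorem continuous_kummerPhiFun (hζ : IsPrimitiveRoot ζ P) (hζk : ζ ∈ k)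
    (ρ : ZMod P × ZMod P →+ M) (a b : (↥k)ˣ) : Continuous (kummerPhiFun P ζ ρ a b) := by
  obtain ⟨U, hU, hU0⟩ := exists_isOpen_unitChar_eq_zero hζ a
  obtain ⟨V, hV, hV0⟩ := exists_isOpen_unitChar_eq_zero hζ b
  refine continuous_of_map_mul_of_subgroup (kummerPhiFun_mul hζ hζk ρ a b) (U ⊓ V)
    (hU.inter hV) fun u hu ↦ ?_
  rw [kummerPhiFun, hU0 u hu.1, hV0 u hu.2, Prod.mk_zero_zero, map_zero]

/-- **`Φ(a, b)` as a continuous cocycle of `𝔤_k` with values in `M`** (the action of `𝔤_k` on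
`M` being trivial, a continuous homomorphism IS a cocycle, `homCocycle`): Clark–Sharif's
`Φ : kˣ/kˣᴾ × kˣ/kˣᴾ → H¹(k, E[P])`, "a choice of basis for `E[P]` yields an isomorphism `Φ`"
(§2.5, §3.5: `Φ = λ ∘ i_* ∘ ψ` with `ψ` the Kummer map), here on `kˣ × kˣ` and for an arbitrary
additive `ρ : (ℤ/Pℤ)² → M`. [cite: ClarkSharif2010, §3.5] -/
def kummerPhiCocycle (hζ : IsPrimitiveRoot ζ P) (hζk : ζ ∈ k)
    (htriv : ∀ (n : fixingGal k) (m : M), n • m = m) (ρ : ZMod P × ZMod P →+ M) (a b : (↥k)ˣ) :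
    contOneCocycles (discreteTopRep (fixingGal k) M) :=
  homCocycle htriv (kummerPhiFun P ζ ρ a b) (kummerPhiFun_mul hζ hζk ρ a b)
    (continuous_kummerPhiFun hζ hζk ρ a b)

/-- Values of `Φ(a, b)`: `n ↦ ρ(f_a(n), f_b(n))`. [cite: ClarkSharif2010, §3.5] -/
@[simp]
theorem kummerPhiCocycle_apply (hζ : IsPrimitiveRoot ζ P) (hζk : ζ ∈ k)
    (htriv : ∀ (n : fixingGal k) (m : M), n • m = m) (ρ : ZMod P × ZMod P →+ M) (a b : (↥k)ˣ)
    (n : fixingGal k) :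
    (kummerPhiCocycle hζ hζk htriv ρ a b).1 n = ρ (unitChar P ζ a n, unitChar P ζ b n) :=
  rfl

/-- **`Φ(a, b) ∈ H¹(𝔤_k, M)`**, the class of `kummerPhiCocycle`. [cite: ClarkSharif2010, §3.5] -/
def kummerPhi (hζ : IsPrimitiveRoot ζ P) (hζk : ζ ∈ k)
    (htriv : ∀ (n : fixingGal k) (m : M), n • m = m) (ρ : ZMod P × ZMod P →+ M) (a b : (↥k)ˣ) :
    subgroupH1 (fixingGal k) M :=
  oneCocycleClass (discreteTopRep (fixingGal k) M) (kummerPhiCocycle hζ hζk htriv ρ a b)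

/-- The cocycle of the class `Φ(a, b)` is `kummerPhiCocycle` (one cocycle per class).
[cite: ClarkSharif2010, §3.5] -/
@[simp]
theorem cocycleOf_kummerPhi (hζ : IsPrimitiveRoot ζ P) (hζk : ζ ∈ k)
    (htriv : ∀ (n : fixingGal k) (m : M), n • m = m) (ρ : ZMod P × ZMod P →+ M) (a b : (↥k)ˣ) :
    cocycleOf (fixingGal k) M htriv (kummerPhi hζ hζk htriv ρ a b) =
      kummerPhiCocycle hζ hζk htriv ρ a b :=
  cocycleOf_oneCocycleClass htriv _

/-- **`Φ` is a homomorphism** `kˣ × kˣ → Z¹(𝔤_k, M)`: `Φ(aa', bb') = Φ(a, b) + Φ(a', b')`.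
[cite: ClarkSharif2010, §3.5] -/
theorem kummerPhiCocycle_mul (hζ : IsPrimitiveRoot ζ P) (hζk : ζ ∈ k)
    (htriv : ∀ (n : fixingGal k) (m : M), n • m = m) (ρ : ZMod P × ZMod P →+ M)
    (a a' b b' : (↥k)ˣ) :
    kummerPhiCocycle hζ hζk htriv ρ (a * a') (b * b') =
      kummerPhiCocycle hζ hζk htriv ρ a b + kummerPhiCocycle hζ hζk htriv ρ a' b' := by
  apply Subtype.ext
  ext n
  rw [add_apply_val, kummerPhiCocycle_apply, kummerPhiCocycle_apply, kummerPhiCocycle_apply,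
    unitChar_mul_left hζ hζk, unitChar_mul_left hζ hζk, ← map_add, Prod.mk_add_mk]

/-- `Φ(aa', bb') = Φ(a, b) + Φ(a', b')` in `H¹`. [cite: ClarkSharif2010, §3.5] -/
theorem kummerPhi_mul (hζ : IsPrimitiveRoot ζ P) (hζk : ζ ∈ k)
    (htriv : ∀ (n : fixingGal k) (m : M), n • m = m) (ρ : ZMod P × ZMod P →+ M)
    (a a' b b' : (↥k)ˣ) :
    kummerPhi hζ hζk htriv ρ (a * a') (b * b') =
      kummerPhi hζ hζk htriv ρ a b + kummerPhi hζ hζk htriv ρ a' b' := by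
  rw [kummerPhi, kummerPhiCocycle_mul, oneCocycleClass_add]
  rfl

/-- `Φ(1, 1) = 0` on cocycles. [folklore] -/
theorem kummerPhiCocycle_one (hζ : IsPrimitiveRoot ζ P) (hζk : ζ ∈ k)
    (htriv : ∀ (n : fixingGal k) (m : M), n • m = m) (ρ : ZMod P × ZMod P →+ M) :
    kummerPhiCocycle hζ hζk htriv ρ (1 : (↥k)ˣ) 1 = 0 := by
  apply Subtype.ext
  ext n
  rw [kummerPhiCocycle_apply, unitChar_one_left hζ hζk, Prod.mk_zero_zero, map_zero]
  rfl

/-- `Φ(1, 1) = 0`. [folklore] -/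
theorem kummerPhi_one (hζ : IsPrimitiveRoot ζ P) (hζk : ζ ∈ k)
    (htriv : ∀ (n : fixingGal k) (m : M), n • m = m) (ρ : ZMod P × ZMod P →+ M) :
    kummerPhi hζ hζk htriv ρ (1 : (↥k)ˣ) 1 = 0 := by
  rw [kummerPhi, kummerPhiCocycle_one, oneCocycleClass_zero]

/-- **`Φ` on monomials**: the cocycle of `Φ(∏ a_i^{m_i}, ∏ b_j^{m'_j})` is
`n ↦ ρ(Σ m_i f_{a_i}(n), Σ m'_j f_{b_j}(n))`. [cite: ClarkSharif2010, §3.5] -/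
theorem kummerPhiCocycle_prod_apply (hζ : IsPrimitiveRoot ζ P) (hζk : ζ ∈ k)
    (htriv : ∀ (n : fixingGal k) (m : M), n • m = m) (ρ : ZMod P × ZMod P →+ M)
    {ι ι' : Type*} (s : Finset ι) (s' : Finset ι') (a : ι → (↥k)ˣ) (b : ι' → (↥k)ˣ)
    (m : ι → ℤ) (m' : ι' → ℤ) (n : fixingGal k) :
    (kummerPhiCocycle hζ hζk htriv ρ (∏ i ∈ s, a i ^ m i) (∏ j ∈ s', b j ^ m' j)).1 n =
      ρ (∑ i ∈ s, m i • unitChar P ζ (a i) n, ∑ j ∈ s', m' j • unitChar P ζ (b j) n) := by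
  rw [kummerPhiCocycle_apply, unitChar_prod_zpow_left hζ hζk, unitChar_prod_zpow_left hζ hζk]

/-- **Kernel of `Φ`** (`K̄/K` Galois, `ρ` injective): `Φ(a, b) = 0 ↔ a, b ∈ (kˣ)ᴾ` — the
injectivity of `Φ` on `(kˣ/kˣᴾ)²` (Kummer theory; Clark–Sharif §2.5/§3.5 "isomorphism `Φ`").
[cite: ClarkSharif2010, §3.5] -/
theorem kummerPhi_eq_zero_iff [IsGalois K (AlgebraicClosure K)] (hζ : IsPrimitiveRoot ζ P)
    (hζk : ζ ∈ k) (htriv : ∀ (n : fixingGal k) (m : M), n • m = m) {ρ : ZMod P × ZMod P →+ M}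
    (hρ : Function.Injective ρ) (a b : (↥k)ˣ) :
    kummerPhi hζ hζk htriv ρ a b = 0 ↔ (∃ x : (↥k)ˣ, x ^ P = a) ∧ ∃ y : (↥k)ˣ, y ^ P = b := by
  rw [kummerPhi, oneCocycleClass_eq_zero_iff_of_trivial htriv, ← unitChar_eq_zero_iff hζ hζk a,
    ← unitChar_eq_zero_iff hζ hζk b]
  constructor
  · intro h
    have h' : ∀ n, unitChar P ζ a n = 0 ∧ unitChar P ζ b n = 0 := fun n ↦ by
      have hn := congrArg (fun f : contOneCocycles (discreteTopRep (fixingGal k) M) ↦ f.1 n) h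
      have hn0 : ρ (unitChar P ζ a n, unitChar P ζ b n) = ρ 0 := by rw [map_zero]; exact hn
      exact Prod.mk_eq_zero.mp (hρ hn0)
    exact ⟨fun n ↦ (h' n).1, fun n ↦ (h' n).2⟩
  · rintro ⟨ha, hb⟩
    apply Subtype.ext
    ext n
    rw [kummerPhiCocycle_apply, ha n, hb n, Prod.mk_zero_zero, map_zero]
    rfl

/-- `Φ` on finite products: `Φ(∏ a_x, ∏ b_x) = Σ Φ(a_x, b_x)`. [cite: ClarkSharif2010, §3.5] -/
theorem kummerPhi_prod (hζ : IsPrimitiveRoot ζ P) (hζk : ζ ∈ k)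
    (htriv : ∀ (n : fixingGal k) (m : M), n • m = m) (ρ : ZMod P × ZMod P →+ M)
    {ι : Type*} (s : Finset ι) (a b : ι → (↥k)ˣ) :
    kummerPhi hζ hζk htriv ρ (∏ x ∈ s, a x) (∏ x ∈ s, b x) =
      ∑ x ∈ s, kummerPhi hζ hζk htriv ρ (a x) (b x) := by
  induction s using Finset.induction_on with
  | empty => rw [Finset.prod_empty, Finset.prod_empty, Finset.sum_empty, kummerPhi_one]
  | insert x s hx ih => rw [Finset.prod_insert hx, Finset.prod_insert hx, Finset.sum_insert hx,
      kummerPhi_mul, ih]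

end Phi

/-! ## The Galois twist (Clark–Sharif 2010, Proposition 16) and `Nm ∘ Φ` (Corollary 17) -/

section Twist

variable {K : Type u} [Field K] {k : IntermediateField K (AlgebraicClosure K)} {P : ℕ} [NeZero P]
  {ζ : AlgebraicClosure K}

/-! ### The cyclotomic character on `μ_P = ⟨ζ⟩` -/

/-- **The mod-`P` cyclotomic character `χ : 𝔤_K → (ℤ/Pℤ)ˣ`**, `σ • ζ = ζ^{χ(σ)}` (Clark–Sharif's
`det M_σ`, by the Weil pairing; here it only matters through its action on `ζ`): a composite
of Mathlib pieces, not a new definition — Mathlib's `modularCyclotomicCharacter` of `K̄` (which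
has `P` `P`-th roots of unity, `hζ.card_rootsOfUnity`) composed with
`𝔤_K → (K̄ ≃+* K̄)` (`MulSemiringAction.toRingAut`).  It is definitionally the tree's
`Literature.NumberTheory.GaloisRepresentations.modNCyclotomicCharacter K P` (file
`ModNCyclotomicCharacter`, stated under `[NeZero (P : K)]` with the root count from
`HasEnoughRootsOfUnity`; the two proofs of the root count are equal by proof irrelevance), see
`cycUnit_eq_modNCyclotomicCharacter`. [cite: ClarkSharif2010, §3.5] -/
def cycUnit (hζ : IsPrimitiveRoot ζ P) (c : absoluteGaloisGroup K) : (ZMod P)ˣ :=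
  modularCyclotomicCharacter (AlgebraicClosure K) hζ.card_rootsOfUnity
    (MulSemiringAction.toRingAut (absoluteGaloisGroup K) (AlgebraicClosure K) c)

/-- `cycUnit` IS the tree's mod-`P` cyclotomic character `modNCyclotomicCharacter K P`
(definitionally). [folklore] -/
theorem cycUnit_eq_modNCyclotomicCharacter [NeZero (P : K)] (hζ : IsPrimitiveRoot ζ P)
    (c : absoluteGaloisGroup K) : cycUnit hζ c = modNCyclotomicCharacter K P c :=
  rfl

/-- `cycUnit hζ` is a group homomorphism `𝔤_K → (ℤ/Pℤ)ˣ`. [folklore] -/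
theorem cycUnit_mul (hζ : IsPrimitiveRoot ζ P) (c c' : absoluteGaloisGroup K) :
    cycUnit hζ (c * c') = cycUnit hζ c * cycUnit hζ c' := by
  unfold cycUnit
  rw [map_mul, map_mul]

/-- `χ(σ) ∈ ℤ/Pℤ`, the mod-`P` cyclotomic character read in `ℤ/Pℤ`. [cite: ClarkSharif2010, §3.5] -/
abbrev cycChar (hζ : IsPrimitiveRoot ζ P) (c : absoluteGaloisGroup K) : ZMod P :=
  (cycUnit hζ c : ZMod P)

/-- `(cycUnit σ : ℤ/Pℤ) = χ(σ)`. [folklore] -/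
theorem coe_cycUnit (hζ : IsPrimitiveRoot ζ P) (c : absoluteGaloisGroup K) :
    (cycUnit hζ c : ZMod P) = cycChar hζ c :=
  rfl

/-- **`ζ^{χ(σ)} = σ • ζ`** (Mathlib's `modularCyclotomicCharacter.spec`). [folklore] -/
theorem rootPow_cycChar (hζ : IsPrimitiveRoot ζ P) (c : absoluteGaloisGroup K) :
    rootPow ζ (cycChar hζ c) = c • ζ :=
  (modularCyclotomicCharacter.spec (AlgebraicClosure K) hζ.card_rootsOfUnity
    (MulSemiringAction.toRingAut (absoluteGaloisGroup K) (AlgebraicClosure K) c)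
    (t := rootsOfUnity.mkOfPowEq ζ hζ.pow_eq_one) (rootsOfUnity.mkOfPowEq ζ hζ.pow_eq_one).2).symm

omit [NeZero P] in
/-- `σ • ζ^e = (σ • ζ)^e`. [folklore] -/
theorem smul_rootPow (c : absoluteGaloisGroup K) (e : ZMod P) :
    c • rootPow ζ e = rootPow (c • ζ) e :=
  smul_pow' c ζ e.val

omit [NeZero P] in
/-- `(ζ^{e'})^{e} = ζ^{e e'}` for `ζ ^ P = 1`. [folklore] -/
theorem rootPow_rootPow (hζ : ζ ^ P = 1) (e e' : ZMod P) :
    rootPow (rootPow ζ e') e = rootPow ζ (e * e') :=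
  (rootPow_mul hζ e e').symm

/-- `χ(σ)⁻¹ χ(σ) = 1` in `ℤ/Pℤ`. [folklore] -/
theorem cycUnit_inv_mul_cycChar (hζ : IsPrimitiveRoot ζ P) (c : absoluteGaloisGroup K) :
    ((cycUnit hζ c)⁻¹ : (ZMod P)ˣ) * cycChar hζ c = 1 :=
  Units.inv_mul _

/-! ### The action of `𝔤_K` on `kˣ` for `k/K` normal -/

variable [Normal K k]

/-- The restriction of `σ ∈ 𝔤_K` to the normal subextension `k/K` (Mathlib's
`AlgEquiv.restrictNormalHom k` after the identity `absoluteGaloisGroup.toAlgEquiv K`). [folklore] -/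
def resField (c : absoluteGaloisGroup K) : (↥k) ≃ₐ[K] ↥k :=
  AlgEquiv.restrictNormalHom k (absoluteGaloisGroup.toAlgEquiv K c)

/-- `(σσ')|_k = σ|_k σ'|_k`. [folklore] -/
theorem resField_mul (c c' : absoluteGaloisGroup K) :
    resField (k := k) (c * c') = resField c * resField c' := by
  unfold resField
  rw [map_mul, map_mul]

/-- `σ|_k` is `σ`: `(σ|_k x : K̄) = σ • x`. [folklore] -/
@[simp]
theorem coe_resField_apply (c : absoluteGaloisGroup K) (x : k) :
    ((resField c x : k) : AlgebraicClosure K) = c • (x : AlgebraicClosure K) :=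
  AlgEquiv.restrictNormal_commutes (absoluteGaloisGroup.toAlgEquiv K c) k x

/-- **The action `a ↦ σ a` of `σ ∈ 𝔤_K` on `kˣ`** (`k/K` normal), Clark–Sharif's `σ a` for
`a ∈ K_Pˣ`, `σ ∈ Gal(K_P/K)` (§3.5, Proposition 16). [cite: ClarkSharif2010, Proposition 16] -/
def galUnit (c : absoluteGaloisGroup K) (a : (↥k)ˣ) : (↥k)ˣ :=
  Units.map (MonoidHomClass.toMonoidHom (resField (k := k) c)) a

/-- `(σ a : K̄) = σ • a`. [folklore] -/
@[simp]
theorem coe_galUnit (c : absoluteGaloisGroup K) (a : (↥k)ˣ) :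
    (((galUnit c a : (↥k)ˣ) : k) : AlgebraicClosure K) = c • ((a : k) : AlgebraicClosure K) := by
  rw [galUnit, Units.coe_map]
  exact coe_resField_apply c (a : k)

/-- `σ (a b) = σ a · σ b` on `kˣ`. [folklore] -/
theorem galUnit_mul (c : absoluteGaloisGroup K) (a b : (↥k)ˣ) :
    galUnit c (a * b) = galUnit c a * galUnit c b :=
  map_mul _ a b

/-- `(σσ') a = σ (σ' a)` on `kˣ`. [folklore] -/
theorem galUnit_mul_left (c c' : absoluteGaloisGroup K) (a : (↥k)ˣ) :
    galUnit (c * c') a = galUnit c (galUnit c' a) := by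
  apply Units.ext
  rw [galUnit, galUnit, galUnit, Units.coe_map, Units.coe_map, Units.coe_map, resField_mul]
  rfl

/-! ### Proposition 16 -/

variable [(fixingGal k).Normal]

/-- **The Kummer character of a Galois conjugate**: for `σ ∈ 𝔤_K`, `a ∈ kˣ` and `n ∈ 𝔤_k`,
`f_{σ a}(n) = χ(σ) · f_a(σ⁻¹ n σ)` — if `α` is a `P`-th root of `a` then `σ α` is one of `σ a`,
and `n (σ α) = σ ((σ⁻¹ n σ) α) = σ (ζ^{f_a(σ⁻¹ n σ)} α) = ζ^{χ(σ) f_a(σ⁻¹ n σ)} σ α`. This is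
the computation `[ψ(a, b)]^σ (γ) = … = σ[i(σ⁻¹ ψ(σ a, σ b)(γ))]` in the proof of Clark–Sharif's
Proposition 16. [cite: ClarkSharif2010, Proposition 16] -/
theorem unitChar_galUnit (hζ : IsPrimitiveRoot ζ P) (hζk : ζ ∈ k) (c : absoluteGaloisGroup K)
    (a : (↥k)ˣ) (n : fixingGal k) :
    unitChar P ζ (galUnit c a) n =
      cycChar hζ c * unitChar P ζ a (subgroupConj (fixingGal k) c n) := by
  have hα : pthRoot P ((a : k) : AlgebraicClosure K) ^ P = ((a : k) : AlgebraicClosure K) :=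
    pthRoot_pow P _
  have hcα : (c • pthRoot P ((a : k) : AlgebraicClosure K)) ^ P =
      ((galUnit c a : (↥k)ˣ) : k) := by
    rw [coe_galUnit, smul_pow_eq c hα]
  apply unitChar_eq_of_smul_eq hζ hζk (galUnit c a) n hcα
  have h1 : (n : absoluteGaloisGroup K) • c • pthRoot P ((a : k) : AlgebraicClosure K) =
      c • ((subgroupConj (fixingGal k) c n : fixingGal k) : absoluteGaloisGroup K) •
        pthRoot P ((a : k) : AlgebraicClosure K) := by
    rw [smul_smul, smul_smul, subgroupConj_apply_coe, ← mul_assoc, ← mul_assoc, mul_inv_cancel,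
      one_mul]
  rw [h1, smul_eq_rootPow_unitChar_mul hζ hζk a _ hα, smul_mul', smul_rootPow,
    ← rootPow_cycChar hζ c, rootPow_rootPow hζ.pow_eq_one, mul_comm (unitChar P ζ a _)]

variable {M : Type u} [AddCommGroup M] [DistribMulAction (absoluteGaloisGroup K) M]
  [TopologicalSpace M] [DiscreteTopology M]

/-- **Clark–Sharif 2010, Proposition 16, on cocycles (abstract form).** For `σ ∈ 𝔤_K` and
`a, b ∈ kˣ`, the conjugate `σ · Φ(a, b) = (n ↦ σ • Φ(a, b)(σ⁻¹ n σ))` is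
`n ↦ σ • ρ(χ(σ)⁻¹ f_{σ a}(n), χ(σ)⁻¹ f_{σ b}(n))`: "`Φ(a, b)^σ = Φ((M_σ / det M_σ)(σ a, σ b))`"
with the two Galois structures separated — `σ` acting on `M` through `ρ` (the matrix `M_σ`) and
on `μ_P` through `χ(σ)` (`= det M_σ` for `M = E[P]` by the Weil pairing).
[cite: ClarkSharif2010, Proposition 16] -/
theorem conjCocycle_kummerPhiCocycle_apply (hζ : IsPrimitiveRoot ζ P) (hζk : ζ ∈ k)
    (htriv : ∀ (n : fixingGal k) (m : M), n • m = m) (ρ : ZMod P × ZMod P →+ M)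
    (c : absoluteGaloisGroup K) (a b : (↥k)ˣ) (n : fixingGal k) :
    (conjCocycle (fixingGal k) c (kummerPhiCocycle hζ hζk htriv ρ a b)).1 n =
      c • ρ ((((cycUnit hζ c)⁻¹ : (ZMod P)ˣ) : ZMod P) * unitChar P ζ (galUnit c a) n,
        (((cycUnit hζ c)⁻¹ : (ZMod P)ˣ) : ZMod P) * unitChar P ζ (galUnit c b) n) := by
  rw [conjCocycle_apply, kummerPhiCocycle_apply, unitChar_galUnit hζ hζk, unitChar_galUnit hζ hζk,
    ← mul_assoc, ← mul_assoc, cycUnit_inv_mul_cycChar, one_mul, one_mul]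

/-- **Clark–Sharif 2010, Proposition 16** (matrix form, on cocycles). If `σ ∈ 𝔤_K` acts on `M`
through `ρ` by the matrix `(i j; k l)` — `σ • ρ(x, y) = ρ(i x + j y, k x + l y)`, Clark–Sharif's
`M_σ` — then `σ · Φ(a, b) = Φ(a', b')` with
`a' = (σa)^{i/χ(σ)} (σb)^{j/χ(σ)}`, `b' = (σa)^{k/χ(σ)} (σb)^{l/χ(σ)}`
("`Φ(a,b)^σ = Φ((M_σ/ det M_σ)(σ a, σ b))`, `M_σ(a, b) = (a^{i(σ)} b^{j(σ)}, a^{k(σ)} b^{l(σ)})`").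
[cite: ClarkSharif2010, Proposition 16] -/
theorem conjCocycle_kummerPhiCocycle (hζ : IsPrimitiveRoot ζ P) (hζk : ζ ∈ k)
    (htriv : ∀ (n : fixingGal k) (m : M), n • m = m) (ρ : ZMod P × ZMod P →+ M)
    (c : absoluteGaloisGroup K) {i j k' l : ZMod P}
    (hA : ∀ x y : ZMod P, c • ρ (x, y) = ρ (i * x + j * y, k' * x + l * y)) (a b : (↥k)ˣ) :
    conjCocycle (fixingGal k) c (kummerPhiCocycle hζ hζk htriv ρ a b) =
      kummerPhiCocycle hζ hζk htriv ρ
        (galUnit c a ^ ((((cycUnit hζ c)⁻¹ : (ZMod P)ˣ) : ZMod P) * i).val *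
          galUnit c b ^ ((((cycUnit hζ c)⁻¹ : (ZMod P)ˣ) : ZMod P) * j).val)
        (galUnit c a ^ ((((cycUnit hζ c)⁻¹ : (ZMod P)ˣ) : ZMod P) * k').val *
          galUnit c b ^ ((((cycUnit hζ c)⁻¹ : (ZMod P)ˣ) : ZMod P) * l).val) := by
  apply Subtype.ext
  ext n
  rw [conjCocycle_kummerPhiCocycle_apply, hA, kummerPhiCocycle_apply, unitChar_mul_left hζ hζk,
    unitChar_mul_left hζ hζk, unitChar_pow_left hζ hζk, unitChar_pow_left hζ hζk,
    unitChar_pow_left hζ hζk, unitChar_pow_left hζ hζk]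
  simp only [nsmul_eq_mul, ZMod.natCast_zmod_val]
  congr 2 <;> ring

/-- **Clark–Sharif 2010, Proposition 16** (matrix form, in `H¹(𝔤_k, M)`): with the notation of
`conjCocycle_kummerPhiCocycle`, `σ_* Φ(a, b) = Φ(a', b')` for the conjugation action `conjH1` of
`σ` on `H¹(𝔤_k, M)`. [cite: ClarkSharif2010, Proposition 16] -/
theorem conjH1_kummerPhi (hζ : IsPrimitiveRoot ζ P) (hζk : ζ ∈ k)
    (htriv : ∀ (n : fixingGal k) (m : M), n • m = m) (ρ : ZMod P × ZMod P →+ M)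
    (c : absoluteGaloisGroup K) {i j k' l : ZMod P}
    (hA : ∀ x y : ZMod P, c • ρ (x, y) = ρ (i * x + j * y, k' * x + l * y)) (a b : (↥k)ˣ) :
    conjH1 (fixingGal k) M c (kummerPhi hζ hζk htriv ρ a b) =
      kummerPhi hζ hζk htriv ρ
        (galUnit c a ^ ((((cycUnit hζ c)⁻¹ : (ZMod P)ˣ) : ZMod P) * i).val *
          galUnit c b ^ ((((cycUnit hζ c)⁻¹ : (ZMod P)ˣ) : ZMod P) * j).val)
        (galUnit c a ^ ((((cycUnit hζ c)⁻¹ : (ZMod P)ˣ) : ZMod P) * k').val *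
          galUnit c b ^ ((((cycUnit hζ c)⁻¹ : (ZMod P)ˣ) : ZMod P) * l).val) := by
  rw [kummerPhi, conjH1_oneCocycleClass, conjCocycle_kummerPhiCocycle hζ hζk htriv ρ c hA]
  rfl

/-! ### Corollary 17: `res ∘ cores ∘ Φ` -/

/-- **Clark–Sharif 2010, Corollary 17: `Nm Φ(a, b) = res (cores Φ(a, b))` is a value of `Φ`.**
For `𝔤_k ≤ 𝔤_K` open and normal (`k = K_P` finite Galois over `K`), a system `s` of
representatives of `𝔤_K / 𝔤_k = Gal(k/K)` acting on `M` through `ρ` by matrices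
`(i_x j_x; k_x l_x)`, and `a, b ∈ kˣ`:
`res (cores Φ(a, b)) = Σ_x (s x)_* Φ(a, b) = Φ(∏_x (σ_x a)^{i_x/χ_x} (σ_x b)^{j_x/χ_x},
∏_x (σ_x a)^{k_x/χ_x} (σ_x b)^{l_x/χ_x})` (`σ_x = s x`, `χ_x = χ(σ_x)`), by Lemma 15
(`Literature.NumberTheory.EllipticCurves.ClarkSharif2010_lemma15`) and Proposition 16
(`conjH1_kummerPhi`): "`Nm Φ((a,b)) = Φ(∏ σa^{i(σ)} σb^{j(σ)}, ∏ σa^{k(σ)} σb^{ℓ(σ)})`, where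
the product extends over all `σ ∈ Gal(K_P/K)`" (the source absorbs `det M_σ` into the
exponents). [cite: ClarkSharif2010, Corollary 17] -/
theorem ClarkSharif2010_cor17 [Fintype (absoluteGaloisGroup K ⧸ fixingGal k)]
    (hζ : IsPrimitiveRoot ζ P) (hζk : ζ ∈ k)
    (htriv : ∀ (n : fixingGal k) (m : M), n • m = m) (ρ : ZMod P × ZMod P →+ M)
    (hN : IsOpen (fixingGal k : Set (absoluteGaloisGroup K)))
    {s : absoluteGaloisGroup K ⧸ fixingGal k → absoluteGaloisGroup K}
    (hs : ∀ x, (s x : absoluteGaloisGroup K ⧸ fixingGal k) = x)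
    {i j k' l : absoluteGaloisGroup K ⧸ fixingGal k → ZMod P}
    (hA : ∀ x (y z : ZMod P), s x • ρ (y, z) = ρ (i x * y + j x * z, k' x * y + l x * z))
    (a b : (↥k)ˣ) :
    resSubgroupH1 (fixingGal k) M (coresH1 (fixingGal k) hN (kummerPhi hζ hζk htriv ρ a b)) =
      kummerPhi hζ hζk htriv ρ
        (∏ x, (galUnit (s x) a ^ ((((cycUnit hζ (s x))⁻¹ : (ZMod P)ˣ) : ZMod P) * i x).val *
          galUnit (s x) b ^ ((((cycUnit hζ (s x))⁻¹ : (ZMod P)ˣ) : ZMod P) * j x).val))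
        (∏ x, (galUnit (s x) a ^ ((((cycUnit hζ (s x))⁻¹ : (ZMod P)ˣ) : ZMod P) * k' x).val *
          galUnit (s x) b ^ ((((cycUnit hζ (s x))⁻¹ : (ZMod P)ˣ) : ZMod P) * l x).val)) := by
  rw [ClarkSharif2010_lemma15 (fixingGal k) hN hs, kummerPhi_prod]
  exact Finset.sum_congr rfl fun x _ ↦ conjH1_kummerPhi hζ hζk htriv ρ (s x) (hA x) a b

end Twist

/-! ## `Φ` is onto (Kummer theory in `Hom` form) -/

section Surjective

variable {K : Type u} [Field K] {k : IntermediateField K (AlgebraicClosure K)} {P : ℕ} [NeZero P]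
  {ζ : AlgebraicClosure K}

/-! ### Open neighbourhoods of `1` in `𝔤_k` -/

omit [NeZero P] in
/-- **An open neighbourhood of `1` in `𝔤_k` contains `Gal(K̄/E)` for some finite `E/k`.**
It contains `𝔤_k ∩ Gal(K̄/L)` for a finite `L/K` (Krull topology, subspace topology), and
`Gal(K̄/E) ⊆ Gal(K̄/L)` for `E = k(L) = k(b_1, …, b_d)`, `(b_i)` a `K`-basis of `L`. [folklore] -/
theorem exists_finiteDimensional_fixingSubgroup_subset {U : Set (fixingGal k)} (hU : IsOpen U)
    (h1 : (1 : fixingGal k) ∈ U) :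
    ∃ E : IntermediateField k (AlgebraicClosure K), FiniteDimensional k E ∧
      ∀ σ ∈ E.fixingSubgroup, (IntermediateField.fixingSubgroupEquiv k).symm σ ∈ U := by
  obtain ⟨V, hV, hVU⟩ := isOpen_induced_iff.mp hU
  have h1V : (1 : absoluteGaloisGroup K) ∈ V := by
    rw [← hVU] at h1
    exact h1
  obtain ⟨L, hL, hLV⟩ :=
    (krullTopology_mem_nhds_one_iff K (AlgebraicClosure K) V).mp (hV.mem_nhds h1V)
  haveI := hL
  let b := Module.finBasis K L
  let S : Set (AlgebraicClosure K) := Set.range fun i ↦ ((b i : L) : AlgebraicClosure K)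
  let E : IntermediateField k (AlgebraicClosure K) := IntermediateField.adjoin k S
  have hE : FiniteDimensional k E :=
    IntermediateField.finiteDimensional_adjoin fun x _ ↦
      (Algebra.IsIntegral.isIntegral (R := K) x).tower_top
  refine ⟨E, hE, fun σ hσ ↦ ?_⟩
  suffices h : ((IntermediateField.fixingSubgroupEquiv k).symm σ).1 ∈ L.fixingSubgroup by
    rw [← hVU]
    exact hLV h
  rw [IntermediateField.mem_fixingSubgroup_iff]
  intro x hx
  -- `σ` fixes the basis vectors `b i ∈ S ⊆ E`, hence `L` pointwise
  have hfix : ∀ i, σ ((b i : L) : AlgebraicClosure K) = ((b i : L) : AlgebraicClosure K) :=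
    fun i ↦ (IntermediateField.mem_fixingSubgroup_iff E σ).mp hσ _
      (IntermediateField.subset_adjoin k S ⟨i, rfl⟩)
  have hxb : x = ∑ i, b.repr ⟨x, hx⟩ i • ((b i : L) : AlgebraicClosure K) := by
    have h := congrArg (fun y : L ↦ (y : AlgebraicClosure K)) (b.sum_repr ⟨x, hx⟩).symm
    simpa only [IntermediateField.coe_sum, IntermediateField.coe_smul] using h
  change (σ.restrictScalars K) x = x
  rw [hxb, map_sum]
  refine Finset.sum_congr rfl fun i _ ↦ ?_
  rw [map_smul]
  exact congrArg _ (hfix i)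

/-! ### Surjectivity of `Φ` -/

variable {M : Type u} [AddCommGroup M] [DistribMulAction (absoluteGaloisGroup K) M]
  [TopologicalSpace M] [DiscreteTopology M]

/-- **Every continuous homomorphism `𝔤_k → ℤ/Pℤ`-coordinate of a cocycle is a Kummer
character.** For a continuous cocycle `θ : 𝔤_k → M` (trivial action) and `ρ : (ℤ/Pℤ)² ≃ M`,
each coordinate of `ρ⁻¹ ∘ θ` is `unitChar P ζ a` for some `a ∈ kˣ` (Kummer theory / Hilbert 90,
`Literature.NumberTheory.EllipticCurves.exists_kummer_generator`). [cite: ClarkSharif2010, §3.5] -/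
theorem exists_unitChar_eq [IsGalois K (AlgebraicClosure K)] (hζ : IsPrimitiveRoot ζ P)
    (hζk : ζ ∈ k) (htriv : ∀ (n : fixingGal k) (m : M), n • m = m)
    (θ : contOneCocycles (discreteTopRep (fixingGal k) M))
    (π : ZMod P × ZMod P →+ ZMod P) (ρ : ZMod P × ZMod P ≃+ M) :
    ∃ a : (↥k)ˣ, ∀ n, unitChar P ζ a n = π (ρ.symm (θ.1 n)) := by
  have hζ' : IsPrimitiveRoot (⟨ζ, hζk⟩ : k) P :=
    IsPrimitiveRoot.of_map_of_injective (f := algebraMap k (AlgebraicClosure K)) hζ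
      (algebraMap k (AlgebraicClosure K)).injective
  let F := IntermediateField.fixingSubgroupEquiv k
  let g : fixingGal k → ZMod P := fun n ↦ π (ρ.symm (θ.1 n))
  have hg : ∀ n m, g (n * m) = g n + g m := fun n m ↦ by
    simp only [g, cocycle_map_mul_of_trivial htriv, map_add]
  obtain ⟨E, hE, hEU⟩ := exists_finiteDimensional_fixingSubgroup_subset (k := k)
    (isOpen_ker_of_continuous θ.1.continuous) (contOneCocycles.apply_one θ)
  let f : (AlgebraicClosure K ≃ₐ[k] AlgebraicClosure K) → ZMod P := fun σ ↦ g (F.symm σ)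
  have hf : ∀ σ τ, f (σ * τ) = f σ + f τ := fun σ τ ↦ by
    show g (F.symm (σ * τ)) = g (F.symm σ) + g (F.symm τ)
    rw [map_mul]
    exact hg _ _
  have hfE : ∃ E : IntermediateField k (AlgebraicClosure K), FiniteDimensional k E ∧
      ∀ σ ∈ E.fixingSubgroup, f σ = 0 :=
    ⟨E, hE, fun σ hσ ↦ by
      have h0 : θ.1 (F.symm σ) = 0 := hEU σ hσ
      simp only [f, g, h0, map_zero]⟩
  obtain ⟨a, ha0, α, hα, hσα⟩ := exists_kummer_generator (NeZero.pos P) hζ' f hf hfE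
  refine ⟨Units.mk0 a ha0, fun n ↦ ?_⟩
  apply unitChar_eq_of_smul_eq hζ hζk (Units.mk0 a ha0) n (α := α)
  · rw [Units.val_mk0]
    exact hα
  · have h := hσα (F n)
    have hFn : f (F n) = g n := by
      simp only [f]
      rw [F.symm_apply_apply]
    rw [hFn] at h
    exact h

/-- **`Φ` is onto `Z¹(𝔤_k, M)`** for `ρ : (ℤ/Pℤ)² ≃ M` and `K̄/K` Galois: every continuous
cocycle of `𝔤_k` with values in the trivial module `M` is `Φ(a, b)` for some `a, b ∈ kˣ`.
With `kummerPhi_eq_zero_iff` this is Clark–Sharif's "a choice of basis for `E[P]` yields an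
isomorphism `Φ : K_Pˣ/K_Pˣᴾ × K_Pˣ/K_Pˣᴾ → H¹(K_P, E[P])`" (§2.5, §3.5).
[cite: ClarkSharif2010, §3.5] -/
theorem kummerPhiCocycle_surjective [IsGalois K (AlgebraicClosure K)] (hζ : IsPrimitiveRoot ζ P)
    (hζk : ζ ∈ k) (htriv : ∀ (n : fixingGal k) (m : M), n • m = m) (ρ : ZMod P × ZMod P ≃+ M)
    (θ : contOneCocycles (discreteTopRep (fixingGal k) M)) :
    ∃ a b : (↥k)ˣ, kummerPhiCocycle hζ hζk htriv ρ.toAddMonoidHom a b = θ := by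
  obtain ⟨a, ha⟩ := exists_unitChar_eq hζ hζk htriv θ (AddMonoidHom.fst _ _) ρ
  obtain ⟨b, hb⟩ := exists_unitChar_eq hζ hζk htriv θ (AddMonoidHom.snd _ _) ρ
  refine ⟨a, b, Subtype.ext (ContinuousMap.ext fun n ↦ ?_)⟩
  rw [kummerPhiCocycle_apply, ha n, hb n]
  change ρ ((ρ.symm (θ.1 n)).1, (ρ.symm (θ.1 n)).2) = θ.1 n
  rw [Prod.mk.eta, AddEquiv.apply_symm_apply]

/-- **`Φ` is onto `H¹(𝔤_k, M)`** (`ρ` bijective, `K̄/K` Galois). [cite: ClarkSharif2010, §3.5] -/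
theorem kummerPhi_surjective [IsGalois K (AlgebraicClosure K)] (hζ : IsPrimitiveRoot ζ P)
    (hζk : ζ ∈ k) (htriv : ∀ (n : fixingGal k) (m : M), n • m = m) (ρ : ZMod P × ZMod P ≃+ M)
    (η : subgroupH1 (fixingGal k) M) :
    ∃ a b : (↥k)ˣ, kummerPhi hζ hζk htriv ρ.toAddMonoidHom a b = η := by
  obtain ⟨a, b, h⟩ := kummerPhiCocycle_surjective hζ hζk htriv ρ (cocycleOf (fixingGal k) M htriv η)
  exact ⟨a, b, by rw [kummerPhi, h, oneCocycleClass_cocycleOf]⟩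

end Surjective

end Literature.NumberTheory.EllipticCurves
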